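import Literature.NumberTheory.GaloisCohomology.Howard2004.DVRKolyvaginBoundProofs
import Literature.NumberTheory.GaloisCohomology.Howard2004.KolyvaginSystemReindex
import Literature.NumberTheory.GaloisCohomology.Howard2004.TowerMorphismPushforward
import HarnessLib

/-!
# Howard 2004, §1.6: `H¹_F(K, T) = lim_k H¹_F(K, T/𝔪^{e_k}T)` is insensitive to the cofinal system of levels —
# two-index reductions and the LIMIT side of the transfer along a cofinal embedding of towers (theorems only)

Topic `NumberTheory/GaloisCohomology/Howard2004` (companion of `TowerReindex` / `KolyvaginSystemReindex`, which
RE-INDEX a tower setting along a cofinal sub-sequence, of `DVRKolyvaginBoundProofs` (`redH1_scalarMapH1`,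
`smulFamily_apply`) and of `CofinalEmbeddingColimitProofs` (the colimit side)).  THEOREMS ONLY: no definition, no
named fact, no instance, no notation, no `sorry`.

WHY (INPUTS row G87 = `Howard2004.thm161_dvrKolyvaginBound` = Howard Thm. 1.6.1; stub `stub_h161` of the μ-crux
stmt-BirchSwinnertonDyer-22642; cell `pub/bsd-print-x9`, seat `bsd-line-x10b-p1-w7` g8 — §2–§5 adapt the unfiled
draft of seat `bsd-line-x10b-p1-w8` g10 (`HOME/x10b-p1-w8/CofinalEmbeddingLimitProofs-NOTFILED-w8g10.lean`) to the
two-index reductions PROVED in §1; brick (COFINAL) of `bsd-line-x10b-p1` LEAD g11's interface note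
`HOME/p1/COFINAL-SPEC-x10b-p1-g11.md` on the «LEVEL-GAP» finding of x10b-p1-w7 g7).  Howard proves Thm. 1.6.1 on
the FULL tower `T^{(k)} = T/𝔪^k T` (arXiv p. 11 L33–34), and the k-induction of Lemma 1.6.4 uses a level of EVERY
exponent; the tree's `DVRSetting`s may be gappy (`e` strictly increasing, e.g. `e_k = m(k+1)` for D1's Eisenstein
towers).  A kernel `thm161` proved for full settings is CONSUMED on a gappy `S` only through a transfer
`Conclusion S' → Conclusion S` along a cofinal embedding `S ↪ S'` (levels `k ↦ σ k`).  Howard: «`H¹_F(K, T) =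
lim H¹_F(K, T/𝔪^kT)`» (arXiv p. 12 L29) — a limit over ℕ is computed on any cofinal sub-sequence.  This file is the
LIMIT half (claims C1 and C3 of the spec), GENERIC over two `AdicTower`s `T` (coarse) and `T'` (fine) and an ABSTRACT
`H¹`-level cofinal embedding (instantiated by `H¹` of module-level isomorphisms in `ConclusionCofinalTransferProofs`):

* `σ : ℕ → ℕ` strictly monotone (the marked levels of `T'`);
* a cast-free two-index reduction family `g a b : H¹(K, T'_a) →+ H¹(K, T'_b)` on the fine tower (`g a a = id`,
  `g b c ∘ g a b = g a c` for `c ≤ b ≤ a`, `g (i+1) i = redH1 i`; the idiom of `TowerRefinementProofs`) — which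
  EXISTS on every tower (§1, `exists_twoIndex_redH1`);
* levelwise additive bijections `Φ k : H¹(K, T_k) → H¹(K, T'_{σ k})` commuting with the scalars `H¹(r ·)`,
  RED-compatible (`Φ k ∘ redH1 k = g (σ (k+1)) (σ k) ∘ Φ (k+1)`) and SELMER-compatible
  (`Φ k c ∈ H¹_{F'}(K, T'_{σ k}) ↔ c ∈ H¹_F(K, T_k)`); the fine Selmer groups are reduction-stable (`hF'red`, =
  `redH1_mem_selmerGroup_of_cond_red` from `cond_red`).

* §1 **`exists_twoIndex_redH1`** (two-index reductions `g` by `Nat.leRec`, packaged as an existence statement),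
  `twoIndex_apply_of_mem_limitH1` (`g a b (x a) = x b` on compatible families), `twoIndex_scalarMapH1`,
  `twoIndex_mem_selmerGroup`, `redH1_mem_selmerGroup_of_cond_red`, `twoIndex_eq_redIterH1` (`g (j+D) j = redIterH1 j D`).
* §2 `eq_of_mem_limitH1_of_forall_eq` (two compatible families agreeing on the marked levels agree),
  `smulFamily_mem_limitH1`.
* §3 restriction / extension: **`exists_mem_limitSelmer_restrict_of_cofinal`** (`x' ↦ x` with `Φ k (x k) = x' (σ k)`),
  **`exists_mem_limitSelmer_extend_of_cofinal`** (`y ↦ y'` with `y' (σ k) = Φ k (y k)`: `y' j := g (σ j) j (Φ j (y j))`).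
* §4 **C1 `exists_isFreeRankOneOn_of_cofinal`**: `IsFreeRankOneOn T' (limitSelmer F') x' → ∃ x, IsFreeRankOneOn T
  (limitSelmer F) x ∧ ∀ k, Φ k (x k) = x' (σ k)` — «`H¹_F(K, T)` is a free rank-one `R`-module» descends.
* §5 **C3 `smulFamily_eq_iff_of_cofinal`**: for `one`, `one'` with `one' (σ k) = Φ k (one k)`, `one' ∈ lim'`:
  `one = r₁ • x ↔ one' = r₁ • x'` (so the length clause `len M ≤ len R/(r₁)` transfers with the same `M`).

HONEST FRAMING: pure tower algebra; `thm161_dvrKolyvaginBound` is NOT proved (nor Lemma 1.6.4, nor the refinement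
constructor (REFINE)); no summit statement is proved; the Birch–Swinnerton-Dyer conjecture is not proved by any of this.
References: [Howard2004HeegnerKolyvagin] §1.6, Thm. 1.6.1 proof (arXiv:1202.6340 p. 11 L33–38, p. 12 L29–55), Rem. 1.2.4
(p. 7 L13–27); [SerreGaloisCohomology1997] I §2.2 (cohomology with coefficients in a projective limit).
-/

set_option autoImplicit false

noncomputable section

open Function NumberField IsDedekindDomain Field
open scoped NumberField ContRepresentation

namespace Literature.NumberTheory.GaloisCohomology.Howard2004

open Literature.NumberTheory.GaloisRepresentations
open Literature.NumberTheory.GaloisRepresentations.DiscreteGaloisModule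
open Literature.NumberTheory.GaloisRepresentations.galoisCohomology

namespace AdicTower

/-! ## §1 Two-index reductions on `H¹` of ONE tower (cast-free evaluation of compatible families) -/

variable {K : Type} [Field K] [NumberField K] {R : Type} [CommRing R] [IsLocalRing R]
  {N : ℕ → Type} [∀ k, AddCommGroup (N k)] [∀ k, TopologicalSpace (N k)] [∀ k, DiscreteTopology (N k)]
  [∀ k, Module R (N k)]

section TwoIndex

variable (T : AdicTower K R N)


omit [NumberField K] in
/-- **Two-index reductions** `g a b : H¹(K, T_a) → H¹(K, T_b)` exist with `g a a = id`, `g b c ∘ g a b = g a c`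
(`c ≤ b ≤ a`) and `g (i+1) i = H¹(red_i)` (the iterated reductions of the tower, packaged without index
transport). [cite: Howard2004HeegnerKolyvagin, §1.6 (arXiv p. 12, L29–33)] [cite: SerreGaloisCohomology1997, Ch. I §2.2] -/
theorem exists_twoIndex_redH1 :
    ∃ g : ∀ a b : ℕ, galoisCohomology (T.ρ a) 1 →+ galoisCohomology (T.ρ b) 1,
      (∀ a (w : galoisCohomology (T.ρ a) 1), g a a w = w) ∧
      (∀ a b c, c ≤ b → b ≤ a → ∀ w : galoisCohomology (T.ρ a) 1, g b c (g a b w) = g a c w) ∧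
      (∀ i (w : galoisCohomology (T.ρ (i + 1)) 1), g (i + 1) i w = T.redH1 i w) := by
  let G : ∀ b a : ℕ, b ≤ a → (galoisCohomology (T.ρ a) 1 →+ galoisCohomology (T.ρ b) 1) :=
    fun b a h => Nat.leRec (motive := fun a _ => galoisCohomology (T.ρ a) 1 →+ galoisCohomology (T.ρ b) 1)
      (AddMonoidHom.id _) (fun a _ acc => acc.comp (T.redH1 a)) h
  have hG0 : ∀ b, G b b le_rfl = AddMonoidHom.id _ := fun b => Nat.leRec_self _ _
  have hGs : ∀ b a (h : b ≤ a), G b (a + 1) (Nat.le_succ_of_le h) = (G b a h).comp (T.redH1 a) :=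
    fun b a h => Nat.leRec_succ _ _ h
  refine ⟨fun a b => if h : b ≤ a then G b a h else 0, ?_, ?_, ?_⟩
  · intro a w
    simp only [le_refl, ↓reduceDIte]
    rw [hG0]
    rfl
  · intro a b c hcb hba w
    simp only [hcb, hba, hcb.trans hba, ↓reduceDIte]
    induction hba with
    | refl =>
      rw [hG0]
      rfl
    | @step a hle ih =>
      rw [hGs b a hle, hGs c a (hcb.trans hle), AddMonoidHom.comp_apply, AddMonoidHom.comp_apply]
      exact ih _
  · intro i w
    simp only [Nat.le_succ, ↓reduceDIte]
    rw [hGs i i le_rfl, hG0]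
    rfl

variable {T}

omit [NumberField K] in
/-- A two-index reduction system evaluates compatible families: `g a b (x a) = x b` for `b ≤ a`, `x ∈ lim`.
[cite: Howard2004HeegnerKolyvagin, §1.6 (arXiv p. 12, L29–33)] -/
theorem twoIndex_apply_of_mem_limitH1 {g : ∀ a b : ℕ, galoisCohomology (T.ρ a) 1 →+ galoisCohomology (T.ρ b) 1}
    (hid : ∀ a (w : galoisCohomology (T.ρ a) 1), g a a w = w)
    (hcomp : ∀ a b c, c ≤ b → b ≤ a → ∀ w : galoisCohomology (T.ρ a) 1, g b c (g a b w) = g a c w)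
    (hstep : ∀ i (w : galoisCohomology (T.ρ (i + 1)) 1), g (i + 1) i w = T.redH1 i w)
    {x : ∀ k, galoisCohomology (T.ρ k) 1} (hx : x ∈ T.limitH1) {a b : ℕ} (hba : b ≤ a) :
    g a b (x a) = x b := by
  induction hba with
  | refl => exact hid b _
  | @step a hle ih =>
    rw [← hcomp (a + 1) a b hle (Nat.le_succ a), hstep, show T.redH1 a (x (a + 1)) = x a from hx a]
    exact ih

omit [NumberField K] in
/-- A two-index reduction system commutes with the scalars `H¹(r •)`.
[cite: Howard2004HeegnerKolyvagin, §1.6 (arXiv p. 12, L29)] -/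
theorem twoIndex_scalarMapH1 {g : ∀ a b : ℕ, galoisCohomology (T.ρ a) 1 →+ galoisCohomology (T.ρ b) 1}
    (hid : ∀ a (w : galoisCohomology (T.ρ a) 1), g a a w = w)
    (hcomp : ∀ a b c, c ≤ b → b ≤ a → ∀ w : galoisCohomology (T.ρ a) 1, g b c (g a b w) = g a c w)
    (hstep : ∀ i (w : galoisCohomology (T.ρ (i + 1)) 1), g (i + 1) i w = T.redH1 i w)
    {a b : ℕ} (hba : b ≤ a) (r : R) (w : galoisCohomology (T.ρ a) 1) :
    g a b (scalarMapH1 (T.ρ a) (T.hlin a) r w) = scalarMapH1 (T.ρ b) (T.hlin b) r (g a b w) := by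
  induction hba with
  | refl => rw [hid, hid]
  | @step a hle ih =>
    rw [← hcomp (a + 1) a b hle (Nat.le_succ a), ← hcomp (a + 1) a b hle (Nat.le_succ a) w, hstep, hstep,
      T.redH1_scalarMapH1, ih]

/-- A two-index reduction system carries Selmer classes to Selmer classes when the one-step reductions do.
[cite: Howard2004HeegnerKolyvagin, Def. 1.1.3 and §1.6 (arXiv p. 5 L93–99, p. 12 L29–33)] -/
theorem twoIndex_mem_selmerGroup {g : ∀ a b : ℕ, galoisCohomology (T.ρ a) 1 →+ galoisCohomology (T.ρ b) 1}
    (hid : ∀ a (w : galoisCohomology (T.ρ a) 1), g a a w = w)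
    (hcomp : ∀ a b c, c ≤ b → b ≤ a → ∀ w : galoisCohomology (T.ρ a) 1, g b c (g a b w) = g a c w)
    (hstep : ∀ i (w : galoisCohomology (T.ρ (i + 1)) 1), g (i + 1) i w = T.redH1 i w)
    (F : ∀ k, SelmerStructure (T.ρ k))
    (hFred : ∀ i (w : galoisCohomology (T.ρ (i + 1)) 1), w ∈ (F (i + 1)).selmerGroup →
      T.redH1 i w ∈ (F i).selmerGroup)
    {a b : ℕ} (hba : b ≤ a) {w : galoisCohomology (T.ρ a) 1} (hw : w ∈ (F a).selmerGroup) :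
    g a b w ∈ (F b).selmerGroup := by
  induction hba with
  | refl => rw [hid]; exact hw
  | @step a hle ih =>
    rw [← hcomp (a + 1) a b hle (Nat.le_succ a), hstep]
    exact ih (hFred a w hw)

/-- The one-step reductions carry Selmer classes to Selmer classes when the level conditions are the reductions of
each other (`cond_red`; localisation is natural). [cite: Howard2004HeegnerKolyvagin, Def. 1.1.3 and §1.6 (arXiv p. 5 L93–99, p. 12 L29–33)] -/
theorem redH1_mem_selmerGroup_of_cond_red (F : ∀ k, SelmerStructure (T.ρ k))
    (hred : ∀ (k : ℕ) (v : Place K), ((F (k + 1)) v).map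
      (ContinuousRep.cohomologyMap ((T.ρ (k + 1)).toLocal v) ((T.ρ k).toLocal v)
        (T.red k).toAddMonoidHom continuous_of_discreteTopology
        (fun _ x => T.red_equivariant k _ x) 1) = F k v)
    (i : ℕ) {w : galoisCohomology (T.ρ (i + 1)) 1} (hw : w ∈ (F (i + 1)).selmerGroup) :
    T.redH1 i w ∈ (F i).selmerGroup := by
  rw [SelmerStructure.mem_selmerGroup_iff] at hw ⊢
  intro v
  have h := localization_cohomologyMap_one (T.ρ (i + 1)) (T.ρ i) (T.red i).toAddMonoidHom
    (T.red_equivariant i) v w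
  change galoisCohomology.localization (T.ρ i) v 1 (ContinuousRep.cohomologyMap (T.ρ (i + 1))
    (T.ρ i) (T.red i).toAddMonoidHom continuous_of_discreteTopology (T.red_equivariant i) 1 w) ∈ F i v
  rw [h, ← hred i v]
  exact AddSubgroup.mem_map_of_mem _ (hw v)

omit [NumberField K] in
/-- A two-index reduction system IS the iterated reduction: `g (j + D) j = redIterH1 j D`.
[cite: Howard2004HeegnerKolyvagin, §1.6 (arXiv p. 12, L29–33)] -/
theorem twoIndex_eq_redIterH1 {g : ∀ a b : ℕ, galoisCohomology (T.ρ a) 1 →+ galoisCohomology (T.ρ b) 1}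
    (hid : ∀ a (w : galoisCohomology (T.ρ a) 1), g a a w = w)
    (hcomp : ∀ a b c, c ≤ b → b ≤ a → ∀ w : galoisCohomology (T.ρ a) 1, g b c (g a b w) = g a c w)
    (hstep : ∀ i (w : galoisCohomology (T.ρ (i + 1)) 1), g (i + 1) i w = T.redH1 i w)
    (j : ℕ) : ∀ (D : ℕ) (w : galoisCohomology (T.ρ (j + D)) 1), g (j + D) j w = T.redIterH1 j D w
  | 0, w => by rw [T.redIterH1_zero]; exact hid j w
  | D + 1, w => by
    rw [T.redIterH1_succ, ← twoIndex_eq_redIterH1 hid hcomp hstep j D,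
      ← hstep (j + D) w]
    exact (hcomp (j + D + 1) (j + D) j (Nat.le_add_right j D) (Nat.le_succ _) w).symm


end TwoIndex

section Cofinal

variable {N' : ℕ → Type} [∀ k, AddCommGroup (N' k)] [∀ k, TopologicalSpace (N' k)] [∀ k, DiscreteTopology (N' k)]
  [∀ k, Module R (N' k)]
  (T : AdicTower K R N) (T' : AdicTower K R N')
  (F : ∀ k, SelmerStructure (T.ρ k)) (F' : ∀ k, SelmerStructure (T'.ρ k))
  (σ : ℕ → ℕ)
  (g : ∀ a b, galoisCohomology (T'.ρ a) 1 →+ galoisCohomology (T'.ρ b) 1)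
  (Φ : ∀ k, galoisCohomology (T.ρ k) 1 →+ galoisCohomology (T'.ρ (σ k)) 1)

/-! ## §2 Compatible families of the fine tower seen from the marked levels -/

omit [NumberField K] in
/-- **Two compatible families of the fine tower that agree on the marked levels `σ k` agree** (`σ` strictly
monotone is cofinal: `j ≤ σ j`, and `x' j = g (σ j) j (x' (σ j))`). [cite: Howard2004HeegnerKolyvagin, §1.6 (arXiv p. 12 L29)] -/
theorem eq_of_mem_limitH1_of_forall_eq (hσ : StrictMono σ)
    (hid : ∀ a (w : galoisCohomology (T'.ρ a) 1), g a a w = w)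
    (hcomp : ∀ a b c, c ≤ b → b ≤ a → ∀ w, g b c (g a b w) = g a c w)
    (hstep : ∀ i (w : galoisCohomology (T'.ρ (i + 1)) 1), g (i + 1) i w = T'.redH1 i w)
    {x' y' : ∀ k, galoisCohomology (T'.ρ k) 1} (hx' : x' ∈ T'.limitH1) (hy' : y' ∈ T'.limitH1)
    (h : ∀ k, x' (σ k) = y' (σ k)) : x' = y' := by
  funext j
  have hj : j ≤ σ j := hσ.id_le j
  rw [← twoIndex_apply_of_mem_limitH1 hid hcomp hstep hx' hj,
    ← twoIndex_apply_of_mem_limitH1 hid hcomp hstep hy' hj, h j]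

omit [NumberField K] in
/-- `r • x' ∈ lim` for `x' ∈ lim` (the reductions are `R`-linear on `H¹`). [cite: Howard2004HeegnerKolyvagin, §1.6 (arXiv p. 12 L29)] -/
theorem smulFamily_mem_limitH1 (r : R) {x' : ∀ k, galoisCohomology (T'.ρ k) 1} (hx' : x' ∈ T'.limitH1) :
    T'.smulFamily r x' ∈ T'.limitH1 := fun k => by
  rw [smulFamily_apply, smulFamily_apply, redH1_scalarMapH1, hx' k]

/-! ## §3 Restriction to and extension from the marked levels -/

/-- **Restriction: a compatible Selmer family of the fine tower restricts, through the `Φ k`, to a compatible Selmer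
family of the coarse tower** (`x k := Φ k⁻¹ (x' (σ k))`; compatibility by RED-compatibility of `Φ` and
`g (σ (k+1)) (σ k) (x' (σ (k+1))) = x' (σ k)`; Selmer by SEL-compatibility).
[cite: Howard2004HeegnerKolyvagin, §1.6, Thm. 1.6.1 proof (arXiv p. 12 L29–33)] -/
theorem exists_mem_limitSelmer_restrict_of_cofinal (hσ : StrictMono σ)
    (hid : ∀ a (w : galoisCohomology (T'.ρ a) 1), g a a w = w)
    (hcomp : ∀ a b c, c ≤ b → b ≤ a → ∀ w, g b c (g a b w) = g a c w)
    (hstep : ∀ i (w : galoisCohomology (T'.ρ (i + 1)) 1), g (i + 1) i w = T'.redH1 i w)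
    (hΦbij : ∀ k, Function.Bijective (Φ k))
    (hΦred : ∀ k (x : galoisCohomology (T.ρ (k + 1)) 1),
      Φ k (T.redH1 k x) = g (σ (k + 1)) (σ k) (Φ (k + 1) x))
    (hΦsel : ∀ k (c : galoisCohomology (T.ρ k) 1), Φ k c ∈ (F' (σ k)).selmerGroup ↔ c ∈ (F k).selmerGroup)
    {x' : ∀ k, galoisCohomology (T'.ρ k) 1} (hx' : x' ∈ T'.limitSelmer F') :
    ∃ x ∈ T.limitSelmer F, ∀ k, Φ k (x k) = x' (σ k) := by
  rw [mem_limitSelmer_iff] at hx'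
  let Ψ : ∀ k, galoisCohomology (T'.ρ (σ k)) 1 → galoisCohomology (T.ρ k) 1 := fun k =>
    (AddEquiv.ofBijective (Φ k) (hΦbij k)).symm
  have hΨ : ∀ k w, Φ k (Ψ k w) = w := fun k w => (AddEquiv.ofBijective (Φ k) (hΦbij k)).apply_symm_apply w
  refine ⟨fun k => Ψ k (x' (σ k)), (mem_limitSelmer_iff T F _).2 ⟨fun k => ?_, fun k => ?_⟩, fun k => hΨ k _⟩
  · apply (hΦbij k).1
    rw [hΦred, hΨ, hΨ]
    exact twoIndex_apply_of_mem_limitH1 hid hcomp hstep hx'.1 (hσ.monotone (Nat.le_succ k))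
  · rw [← hΦsel, hΨ]
    exact hx'.2 (σ k)

omit [NumberField K] in
/-- The marked-level family `k ↦ Φ k (y k)` of a compatible coarse family is compatible along the two-index
reductions between marked levels. [cite: Howard2004HeegnerKolyvagin, §1.6 (arXiv p. 12 L29–33)] -/
theorem twoIndex_apply_marked_of_mem_limitH1 (hσ : StrictMono σ)
    (hid : ∀ a (w : galoisCohomology (T'.ρ a) 1), g a a w = w)
    (hcomp : ∀ a b c, c ≤ b → b ≤ a → ∀ w, g b c (g a b w) = g a c w)
    (hΦred : ∀ k (x : galoisCohomology (T.ρ (k + 1)) 1),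
      Φ k (T.redH1 k x) = g (σ (k + 1)) (σ k) (Φ (k + 1) x))
    {y : ∀ k, galoisCohomology (T.ρ k) 1} (hy : y ∈ T.limitH1) :
    ∀ (d k : ℕ), g (σ (k + d)) (σ k) (Φ (k + d) (y (k + d))) = Φ k (y k)
  | 0, k => hid _ _
  | d + 1, k => by
    change g (σ (k + d + 1)) (σ k) (Φ (k + d + 1) (y (k + d + 1))) = Φ k (y k)
    rw [← hcomp (σ (k + d + 1)) (σ (k + d)) (σ k) (hσ.monotone (Nat.le_add_right k d))
      (hσ.monotone (Nat.le_succ _)), ← hΦred, hy (k + d)]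
    exact twoIndex_apply_marked_of_mem_limitH1 hσ hid hcomp hΦred hy d k

omit [NumberField K] in
/-- Independence of the extension recipe: `g (σ k) j (Φ k (y k))` does not depend on the marked level `σ k ≥ j`
used. [cite: Howard2004HeegnerKolyvagin, §1.6 (arXiv p. 12 L29–33)] -/
theorem twoIndex_apply_marked_eq (hσ : StrictMono σ)
    (hid : ∀ a (w : galoisCohomology (T'.ρ a) 1), g a a w = w)
    (hcomp : ∀ a b c, c ≤ b → b ≤ a → ∀ w, g b c (g a b w) = g a c w)
    (hΦred : ∀ k (x : galoisCohomology (T.ρ (k + 1)) 1),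
      Φ k (T.redH1 k x) = g (σ (k + 1)) (σ k) (Φ (k + 1) x))
    {y : ∀ k, galoisCohomology (T.ρ k) 1} (hy : y ∈ T.limitH1) {j k l : ℕ} (hjk : j ≤ σ k) (hjl : j ≤ σ l) :
    g (σ k) j (Φ k (y k)) = g (σ l) j (Φ l (y l)) := by
  -- compare both with the marked level `σ (max k l)`
  have hk : g (σ k) j (Φ k (y k)) = g (σ (max k l)) j (Φ (max k l) (y (max k l))) := by
    obtain ⟨d, hd⟩ := Nat.exists_eq_add_of_le (le_max_left k l)
    rw [hd, ← twoIndex_apply_marked_of_mem_limitH1 T T' σ g Φ hσ hid hcomp hΦred hy d k,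
      hcomp _ _ _ hjk (hσ.monotone (Nat.le_add_right k d))]
  have hl : g (σ l) j (Φ l (y l)) = g (σ (max k l)) j (Φ (max k l) (y (max k l))) := by
    obtain ⟨d, hd⟩ := Nat.exists_eq_add_of_le (le_max_right k l)
    rw [hd, ← twoIndex_apply_marked_of_mem_limitH1 T T' σ g Φ hσ hid hcomp hΦred hy d l,
      hcomp _ _ _ hjl (hσ.monotone (Nat.le_add_right l d))]
  rw [hk, hl]

/-- **Extension: a compatible Selmer family of the coarse tower extends, through the `Φ k`, to a compatible Selmer
family of the fine tower** — `y' j := g (σ j) j (Φ j (y j))` (`j ≤ σ j`), well defined by the previous lemma,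
compatible, Selmer at every fine level (`twoIndex_mem_selmerGroup`), and `y' (σ k) = Φ k (y k)`.
[cite: Howard2004HeegnerKolyvagin, §1.6, Thm. 1.6.1 proof (arXiv p. 12 L29–33)] -/
theorem exists_mem_limitSelmer_extend_of_cofinal (hσ : StrictMono σ)
    (hid : ∀ a (w : galoisCohomology (T'.ρ a) 1), g a a w = w)
    (hcomp : ∀ a b c, c ≤ b → b ≤ a → ∀ w, g b c (g a b w) = g a c w)
    (hstep : ∀ i (w : galoisCohomology (T'.ρ (i + 1)) 1), g (i + 1) i w = T'.redH1 i w)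
    (hF'red : ∀ i (w : galoisCohomology (T'.ρ (i + 1)) 1), w ∈ (F' (i + 1)).selmerGroup →
      T'.redH1 i w ∈ (F' i).selmerGroup)
    (hΦred : ∀ k (x : galoisCohomology (T.ρ (k + 1)) 1),
      Φ k (T.redH1 k x) = g (σ (k + 1)) (σ k) (Φ (k + 1) x))
    (hΦsel : ∀ k (c : galoisCohomology (T.ρ k) 1), Φ k c ∈ (F' (σ k)).selmerGroup ↔ c ∈ (F k).selmerGroup)
    {y : ∀ k, galoisCohomology (T.ρ k) 1} (hy : y ∈ T.limitSelmer F) :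
    ∃ y' ∈ T'.limitSelmer F', ∀ k, y' (σ k) = Φ k (y k) := by
  rw [mem_limitSelmer_iff] at hy
  have hy1 : y ∈ T.limitH1 := hy.1
  have hle : ∀ j, j ≤ σ j := fun j => hσ.id_le j
  refine ⟨fun j => g (σ j) j (Φ j (y j)), (mem_limitSelmer_iff T' F' _).2 ⟨fun j => ?_, fun j => ?_⟩,
    fun k => ?_⟩
  · -- compatibility: reduce from the marked level `σ (j+1) ≥ j+1 ≥ j`
    rw [← hstep, hcomp _ _ _ (Nat.le_succ j) (hle (j + 1))]
    exact twoIndex_apply_marked_eq T T' σ g Φ hσ hid hcomp hΦred hy1 ((Nat.le_succ j).trans (hle _))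
      (hle j)
  · -- Selmer at the fine level `j`
    exact twoIndex_mem_selmerGroup hid hcomp hstep F' hF'red (hle j) ((hΦsel j _).2 (hy.2 j))
  · change g (σ (σ k)) (σ k) (Φ (σ k) (y (σ k))) = Φ k (y k)
    rw [twoIndex_apply_marked_eq T T' σ g Φ hσ hid hcomp hΦred hy1 (hle (σ k)) le_rfl, hid]

/-! ## §4 C1: «`H¹_F(K, T)` is free of rank one» descends along a cofinal embedding -/

/-- **C1 (limit side).**  If `H¹_{F'}(K, T') = lim` of the fine tower is free of rank one on `x'`, then
`H¹_F(K, T) = lim` of the coarse tower is free of rank one on the restricted generator `x` (`Φ k (x k) = x' (σ k)`):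
the annihilator of `x` vanishes because `r · x'` and `0` agree on the marked levels, hence everywhere; every
compatible Selmer family `y` of the coarse tower extends to `y' = r · x'`, whence `y = r · x` levelwise by the
injectivity of the `Φ k`. [cite: Howard2004HeegnerKolyvagin, Thm. 1.6.1 (i) and §1.6 (arXiv p. 11 L25–26, p. 12 L29–33)] -/
theorem exists_isFreeRankOneOn_of_cofinal (hσ : StrictMono σ)
    (hid : ∀ a (w : galoisCohomology (T'.ρ a) 1), g a a w = w)
    (hcomp : ∀ a b c, c ≤ b → b ≤ a → ∀ w, g b c (g a b w) = g a c w)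
    (hstep : ∀ i (w : galoisCohomology (T'.ρ (i + 1)) 1), g (i + 1) i w = T'.redH1 i w)
    (hF'red : ∀ i (w : galoisCohomology (T'.ρ (i + 1)) 1), w ∈ (F' (i + 1)).selmerGroup →
      T'.redH1 i w ∈ (F' i).selmerGroup)
    (hΦbij : ∀ k, Function.Bijective (Φ k))
    (hΦsmul : ∀ k (r : R) (c : galoisCohomology (T.ρ k) 1),
      Φ k (galoisCohomology.scalarMapH1 (T.ρ k) (T.hlin k) r c) =
        galoisCohomology.scalarMapH1 (T'.ρ (σ k)) (T'.hlin (σ k)) r (Φ k c))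
    (hΦred : ∀ k (x : galoisCohomology (T.ρ (k + 1)) 1),
      Φ k (T.redH1 k x) = g (σ (k + 1)) (σ k) (Φ (k + 1) x))
    (hΦsel : ∀ k (c : galoisCohomology (T.ρ k) 1), Φ k c ∈ (F' (σ k)).selmerGroup ↔ c ∈ (F k).selmerGroup)
    {x' : ∀ k, galoisCohomology (T'.ρ k) 1} (hx' : T'.IsFreeRankOneOn (T'.limitSelmer F') x') :
    ∃ x : ∀ k, galoisCohomology (T.ρ k) 1, T.IsFreeRankOneOn (T.limitSelmer F) x ∧ ∀ k, Φ k (x k) = x' (σ k) := by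
  obtain ⟨hx'mem, hx'ann, hx'gen⟩ := hx'
  have hx'1 : x' ∈ T'.limitH1 := ((mem_limitSelmer_iff T' F' x').1 hx'mem).1
  obtain ⟨x, hx, hΦx⟩ := exists_mem_limitSelmer_restrict_of_cofinal T T' F F' σ g Φ hσ hid hcomp hstep hΦbij
    hΦred hΦsel hx'mem
  refine ⟨x, ⟨hx, fun r hr => hx'ann r ?_, fun y hy => ?_⟩, hΦx⟩
  · -- `r · x' = 0`: both sides are compatible and agree on the marked levels
    refine eq_of_mem_limitH1_of_forall_eq T' σ g hσ hid hcomp hstep (smulFamily_mem_limitH1 T' r hx'1)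
      (zero_mem _) fun k => ?_
    have h : galoisCohomology.scalarMapH1 (T.ρ k) (T.hlin k) r (x k) = 0 := by
      simpa [smulFamily_apply] using congr_fun hr k
    change galoisCohomology.scalarMapH1 (T'.ρ (σ k)) (T'.hlin (σ k)) r (x' (σ k)) = 0
    rw [← hΦx, ← hΦsmul, h, map_zero]
  · obtain ⟨y', hy', hΦy⟩ := exists_mem_limitSelmer_extend_of_cofinal T T' F F' σ g Φ hσ hid hcomp hstep
      hF'red hΦred hΦsel hy
    obtain ⟨r, hr⟩ := hx'gen y' hy'
    refine ⟨r, funext fun k => (hΦbij k).1 ?_⟩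
    rw [← hΦy, hr, smulFamily_apply, smulFamily_apply, hΦsmul, hΦx]

/-! ## §5 C3: the length clause — `one = r₁ · x ↔ one' = r₁ · x'` -/

omit [NumberField K] in
/-- **C3.**  For bottom classes `one`, `one'` with `one' (σ k) = Φ k (one k)` and `one' ∈ lim'`, and generators with
`Φ k (x k) = x' (σ k)`, `x' ∈ lim'`: `one = r₁ · x ↔ one' = r₁ · x'` (→: two compatible families agreeing on the
marked levels; ←: injectivity of `Φ k`).  Hence the printed length bound `len M ≤ len (R/r₁R)` for the fine tower IS
the bound for the coarse one, with the same `M`. [cite: Howard2004HeegnerKolyvagin, Thm. 1.6.1 (iii) (arXiv p. 11 L27–28, p. 12 L50–55)] -/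
theorem smulFamily_eq_iff_of_cofinal (hσ : StrictMono σ)
    (hid : ∀ a (w : galoisCohomology (T'.ρ a) 1), g a a w = w)
    (hcomp : ∀ a b c, c ≤ b → b ≤ a → ∀ w, g b c (g a b w) = g a c w)
    (hstep : ∀ i (w : galoisCohomology (T'.ρ (i + 1)) 1), g (i + 1) i w = T'.redH1 i w)
    (hΦbij : ∀ k, Function.Bijective (Φ k))
    (hΦsmul : ∀ k (r : R) (c : galoisCohomology (T.ρ k) 1),
      Φ k (galoisCohomology.scalarMapH1 (T.ρ k) (T.hlin k) r c) =
        galoisCohomology.scalarMapH1 (T'.ρ (σ k)) (T'.hlin (σ k)) r (Φ k c))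
    {one : ∀ k, galoisCohomology (T.ρ k) 1} {one' : ∀ k, galoisCohomology (T'.ρ k) 1}
    (hone' : one' ∈ T'.limitH1) (hone : ∀ k, one' (σ k) = Φ k (one k))
    {x : ∀ k, galoisCohomology (T.ρ k) 1} {x' : ∀ k, galoisCohomology (T'.ρ k) 1}
    (hx' : x' ∈ T'.limitH1) (hΦx : ∀ k, Φ k (x k) = x' (σ k)) (r₁ : R) :
    one = T.smulFamily r₁ x ↔ one' = T'.smulFamily r₁ x' := by
  constructor
  · intro h
    refine eq_of_mem_limitH1_of_forall_eq T' σ g hσ hid hcomp hstep hone' (smulFamily_mem_limitH1 T' r₁ hx')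
      fun k => ?_
    rw [hone, h, smulFamily_apply, smulFamily_apply, hΦsmul, hΦx]
  · intro h
    funext k
    apply (hΦbij k).1
    rw [← hone, h, smulFamily_apply, smulFamily_apply, hΦsmul, hΦx]

end Cofinal

end AdicTower

end Literature.NumberTheory.GaloisCohomology.Howard2004

end
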